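import Mathlib
import HarnessLib
import Summits.ResolutionOfSingularities.ResolutionOfSingularities.Theorems.WildQuotientsWildQuotientResolutionQuotientModelProperBirational
import Summits.ResolutionOfSingularities.ResolutionOfSingularities.Theorems.WildQuotientsWildQuotientResolutionAffineQuotientData
import Literature.AlgebraicGeometry.RelativeSpec.FiniteGroupQuotientUniversal
import Literature.AlgebraicGeometry.Resolution.AlterationsProofs
import Literature.AlgebraicGeometry.Resolution.BlowupPrincipalCharts

/-!
# The (b) étale-locus port S1c: an affine model `X′ = Spec B` closes the abstract datum of `CyclicQuotientFourfolds`

(crux stmt-ResolutionOfSingularities-15640 `WildQuotients.WildQuotientResolution` and its first open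
case stmt-ResolutionOfSingularities-17941 `WildQuotients.CyclicQuotientFourfolds`; `L/w45c/CHAIN.md`
v9 §5 item S1c (res-L1-w45c-plan-1 ORDER 15:02:18Z on this seat's memo `S1-17941-MEMO.md`).
[OURS · L1 W4.5c] — NOT a statement of any manuscript (Hironaka 2017 is consumed nowhere); replaces
the role of no printed item. Prover res-L1-w45c-stub-1. AI-written Lean, kernel-checked; weaker
than expert review.)

The items 15640/17941 quantify over the ABSTRACT datum `(X′, X₁, q : X′ → X₁, ρ : G →* Aut X′)`
(`q` finite surjective with the `G`-orbits as fibres, étale over a dense open; `X₁` integral,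
separated of finite type over `k`, NOT assumed normal or affine), while every landed rung of the
chain (`jordanThree_hasResolution`, `jordanFour_hasResolution`, `jordanBlockFourfold`,
`linearCyclicQuotientFourfold_hasResolution`, …) concludes the CONCRETE
`Scheme.HasResolution (Spec B^G)` for `B = k[x₁,…,xₙ]`, `G = ⟨σ⟩`. This file is the port:

* `SubringDatum.isIso_openCover_top`, `SubringDatum.isIso_fromSpec_of_bijective` — a relative
  spectrum `Spec_Y(D)` over an AFFINE base `Y` is its `⊤`-chart `Spec (D.ring ⊤)`, so
  `Spec_Y(D) → Y` is an isomorphism as soon as `Γ(Y, ⊤) → D.ring ⊤` is bijective;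
* `ΓSpecIso_appLE_preimage_top`, `bijective_diagramMap_invariants_top` — for the affine-quotient
  action `ρ g = Spec (g⁻¹)` on `Spec B` over `Spec B^G` the invariant sections over `⊤` are exactly
  `B^G`, so `isIso_quotientToBase_affineQuotient`: the tree's quotient
  `(Spec B)/G = Spec_{Spec B^G}((q_*𝒪)^G)` IS `Spec B^G`;
* `hasResolution_of_affineQuotientModel` — **the port**: for the abstract datum with
  `X′ = Spec B` and `ρ` the affine-quotient action, `HasResolution (Spec B^G) → HasResolution X₁`
  (the glued quotient `X′/G` over `X₁` of `…QuotientModelProperBirational` is proper birational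
  over `X₁` (p459590's Q1) and, by the two universal properties (`ActionOver.gluedDesc`,
  `ActionOver.desc`), isomorphic to `(Spec B)/G = Spec B^G`);
* `hasResolution_of_affineSpaceModel` — the instance `B = k[x₁,…,xₙ]`, `G = ⟨σ⟩ ≤ Aut_k k[x]`
  (any `σ` of finite order, linear or not): its hypothesis is LITERALLY the conclusion shape
  `Scheme.HasResolution (Spec (.of ↥(FixedPoints.subalgebra k (MvPolynomial (Fin n) k) ↥(zpowers σ))))`
  of the rungs, so each of them closes every 17941-datum whose top is `(𝔸ⁿ_k, ⟨σ⟩)`.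
-/

-- single-problem summit: the doubled namespace component `ResolutionOfSingularities` is forced
set_option linter.dupNamespace false

noncomputable section

universe u

open CategoryTheory Limits AlgebraicGeometry TopologicalSpace Opposite
open Literature.AlgebraicGeometry.Resolution Literature.AlgebraicGeometry.RelativeSpec

namespace Summit.ResolutionOfSingularities.ResolutionOfSingularities.Theorems.WildQuotientResolution.QuotientModel

/-! ## Relative spectra over an affine base -/

section AffineBase

variable {X Y : Scheme.{u}} {f : X ⟶ Y} [QuasiCompact f] [QuasiSeparated f] (D : SubringDatum f)

/-- **Over an affine base the `⊤`-chart `Spec (D.ring ⊤) ⟶ Spec_Y(D)` is an isomorphism** (it is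
an open immersion whose range is `(Spec_Y(D) → Y)⁻¹ ⊤`). [folklore] -/
theorem SubringDatum.isIso_openCover_top [IsAffine Y] :
    IsIso (D.openCover.f (⟨⊤, isAffineOpen_top Y⟩ : Y.affineOpens)) := by
  apply isIso_of_isOpenImmersion_of_opensRange_eq_top
  exact (D.fromSpec_preimage (⟨⊤, isAffineOpen_top Y⟩ : Y.affineOpens)).symm

/-- **Over an affine base, `Spec_Y(D) → Y` is an isomorphism as soon as `Γ(Y, ⊤) → D.ring ⊤` is
bijective.** [folklore] -/
theorem SubringDatum.isIso_fromSpec_of_bijective [IsAffine Y]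
    (h : Function.Bijective (D.diagramMap.app (op ⊤))) : IsIso D.fromSpec := by
  have h1 : IsIso (D.openCover.f (⟨⊤, isAffineOpen_top Y⟩ : Y.affineOpens)) :=
    SubringDatum.isIso_openCover_top D
  -- the ring map over `⊤` is an isomorphism
  haveI : IsIso (D.diagramMap.app (op ⊤)) := by
    let e := RingEquiv.ofBijective (D.diagramMap.app (op ⊤)).hom h
    refine ⟨⟨CommRingCat.ofHom e.symm.toRingHom, ?_, ?_⟩⟩
    · ext x; exact e.symm_apply_apply x
    · ext x; exact e.apply_symm_apply x
  -- `⊤.fromSpec : Spec Γ(Y, ⊤) → Y` is an isomorphism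
  haveI : IsIso (isAffineOpen_top Y).fromSpec := by
    rw [← IsAffineOpen.isoSpec_inv_ι]
    haveI : IsIso (⊤ : Y.Opens).ι := (inferInstance : IsIso Y.topIso.hom)
    infer_instance
  have hc := D.ι_fromSpec (⟨⊤, isAffineOpen_top Y⟩ : Y.affineOpens)
  have hI : IsIso (Spec.map (D.diagramMap.app (op ⊤)) ≫ (isAffineOpen_top Y).fromSpec) :=
    inferInstance
  rw [← hc] at hI
  exact @IsIso.of_isIso_comp_left _ _ _ _ _ _ D.fromSpec h1 hI

end AffineBase

/-! ## The affine quotient `Spec B → Spec B^G`: invariant sections over `⊤` -/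

section Invariants

variable (k : Type) [Field k] {B : Type} [CommRing B] [Algebra k B]
  {G : Type} [Group G] [Finite G] [MulSemiringAction G B] [SMulCommClass G k B]

/-- The quotient map `q_A : Spec B → Spec B^G` (local shorthand). -/
local notation3 "qA" => Spec.map (CommRingCat.ofHom
  (algebraMap (FixedPoints.subalgebra k B G) B))

omit [Field k] [Algebra k B] [Finite G] [MulSemiringAction G B] [SMulCommClass G k B] in
/-- **Sections of `Spec B` over `q⁻¹⊤` pulled back along `Spec ψ`** read, through
`Γ(Spec B, ⊤) ≅ B`, as `ψ`. [folklore] -/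
theorem ΓSpecIso_appLE_preimage_top {Z : Scheme.{0}} (q : Spec (CommRingCat.of B) ⟶ Z)
    (ψ : B →+* B)
    (e : q ⁻¹ᵁ ⊤ ≤ Spec.map (CommRingCat.ofHom ψ) ⁻¹ᵁ (q ⁻¹ᵁ ⊤))
    (x : Γ(Spec (CommRingCat.of B), q ⁻¹ᵁ ⊤)) :
    (Scheme.ΓSpecIso (CommRingCat.of B)).hom
        ((Spec.map (CommRingCat.ofHom ψ)).appLE (q ⁻¹ᵁ ⊤) (q ⁻¹ᵁ ⊤) e x) =
      ψ ((Scheme.ΓSpecIso (CommRingCat.of B)).hom x) := by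
  have hmap : (Spec (CommRingCat.of B)).presheaf.map (homOfLE e).op = 𝟙 _ := by
    have h1 : (homOfLE e).op = 𝟙 (op (⊤ : (Spec (CommRingCat.of B)).Opens)) := rfl
    rw [h1]
    exact (Spec (CommRingCat.of B)).presheaf.map_id _
  have happ : (Spec.map (CommRingCat.ofHom ψ)).appLE (q ⁻¹ᵁ ⊤) (q ⁻¹ᵁ ⊤) e =
      (Spec.map (CommRingCat.ofHom ψ)).appTop := by
    rw [Scheme.Hom.appLE, hmap]
    erw [Category.comp_id]
    rfl
  have key : ∀ y : Γ(Spec (CommRingCat.of B), ⊤), (Scheme.ΓSpecIso (CommRingCat.of B)).hom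
      ((Spec.map (CommRingCat.ofHom ψ)).appTop y) =
        ψ ((Scheme.ΓSpecIso (CommRingCat.of B)).hom y) := by
    intro y
    rw [← CommRingCat.comp_apply, Scheme.ΓSpecIso_naturality, CommRingCat.comp_apply]
    rfl
  rw [happ]
  exact key x

/-- **The invariant sections of `Spec B` over `⊤`, for the affine-quotient action over
`Spec B^G`, are exactly `B^G`**: the structure map `Γ(Spec B^G, ⊤) → ((q_A)_*𝒪)^G(⊤)` of the
invariants datum is bijective. [cite: SGA1, Exp. V, Prop. 1.1] -/
theorem bijective_diagramMap_invariants_top (ρA : ActionOver qA G)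
    (hρ : ∀ g : G, (ρA.aut g).hom =
      Spec.map (CommRingCat.ofHom ((MulSemiringAction.toRingEquiv G B g⁻¹ : B ≃+* B) : B →+* B))) :
    Function.Bijective (ρA.invariants.diagramMap.app (op ⊤)) := by
  -- `q_A` on global sections is `B^G ⊆ B` through the two `ΓSpecIso`s
  have happ : (qA).appTop = (Scheme.ΓSpecIso _).hom ≫
      CommRingCat.ofHom (algebraMap (FixedPoints.subalgebra k B G) B) ≫ (Scheme.ΓSpecIso _).inv := by
    rw [Scheme.ΓSpecIso_inv_naturality, Iso.hom_inv_id_assoc]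
  -- the action on sections over `⊤` is the action of `G` on `B`
  have hact : ∀ (g : G) (x : Γ(Spec (CommRingCat.of B), (qA) ⁻¹ᵁ ⊤)),
      (Scheme.ΓSpecIso (CommRingCat.of B)).hom (ρA.act g ⊤ x) =
        g • (Scheme.ΓSpecIso (CommRingCat.of B)).hom x := by
    intro g x
    rw [ActionOver.act_apply, appLE_congr_hom (hρ g⁻¹), ΓSpecIso_appLE_preimage_top]
    simp only [inv_inv, RingHom.coe_coe, MulSemiringAction.toRingEquiv_apply_apply]
  constructor
  · -- injective: `q_A♯` is injective on global sections
    intro a b h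
    have h' : (qA).appTop a = (qA).appTop b := by
      change (ρA.invariants.diagramMap.app (op ⊤) ≫
          CommRingCat.ofHom (ρA.invariants.ring ⊤).subtype) a =
        (ρA.invariants.diagramMap.app (op ⊤) ≫
          CommRingCat.ofHom (ρA.invariants.ring ⊤).subtype) b
      exact congrArg (fun z => (CommRingCat.ofHom (ρA.invariants.ring ⊤).subtype) z) h
    rw [happ, CommRingCat.comp_apply, CommRingCat.comp_apply, CommRingCat.comp_apply,
      CommRingCat.comp_apply] at h'
    -- peel the three maps `ΓSpecIso.hom`, `B^G ⊆ B`, `ΓSpecIso.inv`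
    have h2 := congrArg (Scheme.ΓSpecIso (CommRingCat.of B)).hom h'
    rw [Iso.inv_hom_id_apply, Iso.inv_hom_id_apply] at h2
    have h3 : (Scheme.ΓSpecIso _).hom a = (Scheme.ΓSpecIso _).hom b := Subtype.val_injective h2
    have h4 := congrArg (Scheme.ΓSpecIso
      (CommRingCat.of ↥(FixedPoints.subalgebra k B G))).inv h3
    rwa [Iso.hom_inv_id_apply, Iso.hom_inv_id_apply] at h4
  · -- surjective: an invariant section is (the image of) an element of `B^G`
    rintro ⟨x, hx⟩
    have hx' : ∀ g : G, g • (Scheme.ΓSpecIso (CommRingCat.of B)).hom x =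
        (Scheme.ΓSpecIso (CommRingCat.of B)).hom x := by
      intro g
      rw [← hact g x]
      exact congrArg _ ((ρA.mem_invariantsRing_iff ⊤ x).mp hx g)
    refine ⟨(Scheme.ΓSpecIso _).inv ⟨(Scheme.ΓSpecIso (CommRingCat.of B)).hom x, hx'⟩,
      Subtype.ext ?_⟩
    change ((ρA.invariants.diagramMap.app (op ⊤) ≫
      CommRingCat.ofHom (ρA.invariants.ring ⊤).subtype) _) = x
    rw [SubringDatum.diagramMap_app_subtype]
    change (qA).appTop _ = x
    rw [happ, CommRingCat.comp_apply, CommRingCat.comp_apply, Iso.inv_hom_id_apply]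
    change (Scheme.ΓSpecIso (CommRingCat.of B)).inv
      ((Scheme.ΓSpecIso (CommRingCat.of B)).hom x) = x
    rw [Iso.hom_inv_id_apply]

/-- **`(Spec B)/G → Spec B^G` is an isomorphism**: the tree's quotient
`Spec_{Spec B^G}(((q_A)_*𝒪)^G)` of `Spec B` by the affine-quotient action IS `Spec B^G`.
[cite: SGA1, Exp. V, Prop. 1.1] [cite: MumfordAV1970, §7 Thm. p. 66] -/
theorem isIso_quotientToBase_affineQuotient (ρA : ActionOver qA G)
    (hρ : ∀ g : G, (ρA.aut g).hom =
      Spec.map (CommRingCat.ofHom ((MulSemiringAction.toRingEquiv G B g⁻¹ : B ≃+* B) : B →+* B))) :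
    IsIso ρA.quotientToBase :=
  SubringDatum.isIso_fromSpec_of_bijective ρA.invariants
    (bijective_diagramMap_invariants_top k ρA hρ)

end Invariants

/-! ## The port -/

section Port

variable (k : Type) [Field k]

/-- **S1c, general affine model.** For the abstract quotient datum of `WildQuotientResolution` /
`CyclicQuotientFourfolds` whose top is an AFFINE `G`-scheme `X′ = Spec B` with the
affine-quotient action `ρ g = Spec (g⁻¹)` (`B` a domain over `k`, `G` finite acting
faithfully by `k`-algebra automorphisms): if `Spec B^G` has a resolution, so does `X₁` — for ANY
`X₁` (integral, separated, of finite type; not assumed normal or affine) receiving a finite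
surjective `G`-invariant `q : Spec B → X₁` with orbit fibres, étale over a dense open.
[OURS · L1 W4.5c] [folklore; assembly of landed decls: Q1 `quotientModel_proper_birational`
+ the universal properties `ActionOver.gluedDesc` / `ActionOver.desc`
+ `isIso_quotientToBase_affineQuotient`] -/
theorem hasResolution_of_affineQuotientModel {B : Type} [CommRing B] [IsDomain B] [Algebra k B]
    {G : Type} [Group G] [Finite G] [MulSemiringAction G B]
    [SMulCommClass G k B] [FaithfulSMul G B]
    (X₁ : Scheme.{0}) (f : X₁ ⟶ Spec (.of k)) (q : Spec (.of B) ⟶ X₁)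
    (ρ : G →* Aut (Spec (.of B)))
    (hρ : ∀ g : G, (ρ g).hom =
      Spec.map (CommRingCat.ofHom ((MulSemiringAction.toRingEquiv G B g⁻¹ : B ≃+* B) : B →+* B)))
    [IsSeparated f] [LocallyOfFiniteType f] [IsIntegral X₁] [IsFinite q]
    (hsurj : Function.Surjective q.base)
    (hU : ∃ U : X₁.Opens, Dense (U : Set X₁) ∧ Etale (q ∣_ U))
    (hq : ∀ g : G, (ρ g).hom ≫ q = q)
    (horb : ∀ x y : Spec (.of B), q.base x = q.base y → ∃ g : G, (ρ g).hom.base x = y)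
    (hres : Scheme.HasResolution (Spec (.of ↥(FixedPoints.subalgebra k B G)))) :
    Scheme.HasResolution X₁ := by
  classical
  haveI : X₁.IsSeparated := ⟨by rw [← terminal.comp_from f]; infer_instance⟩
  -- dimension zero: `X₁` is regular, the identity resolves
  by_cases hdim : topologicalKrullDim X₁ ≤ 0
  · exact ⟨X₁, 𝟙 X₁, ⟨inferInstance, ⟨⊤, by simp, by simp, inferInstance⟩,
      Scheme.IsRegular.of_topologicalKrullDim_le_zero hdim⟩⟩
  -- the glued quotient `(Spec B)/G` over `X₁` is integral, proper and birational over `X₁` (Q1)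
  have hfaith : Function.Injective ρ := AffineQuotient.specAction_injective ρ hρ
  let ρB : ActionOver (𝟙 (Spec (.of B)) ≫ q) G :=
    ⟨ρ, fun g => by rw [Category.id_comp]; exact hq g⟩
  haveI : IsAffine ((⊤ : (Spec (CommRingCat.of B)).Opens) : Scheme.{0}) := isAffineOpen_top _
  haveI : IsAffineHom ((⊤ : (Spec (CommRingCat.of B)).Opens).ι ≫ 𝟙 (Spec (.of B)) ≫ q) :=
    isAffineHom_of_isAffine_of_isSeparated _
  let Otop : ρB.StableAffineOpens := ⟨⊤, fun g => rfl, inferInstance⟩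
  have hcov : ∀ v : Spec (.of B), ∃ O : ρB.StableAffineOpens, v ∈ O.1 :=
    fun v => ⟨Otop, trivial⟩
  have hbir : IsBirational (𝟙 (Spec (CommRingCat.of B))) := ⟨⊤, by simp, by simp, inferInstance⟩
  obtain ⟨hY, hr, hrbir⟩ := quotientModel_proper_birational k (Spec (.of B)) X₁ f q G ρ hfaith
    hdim hsurj hU horb (Spec (.of B)) (𝟙 _) hbir ρB (fun g => by simp [ρB]) hcov
  haveI := hY
  haveI := hr
  haveI : ρB.glued.IsSeparated :=
    ⟨by rw [← terminal.comp_from (ρB.gluedDesc (𝟙 _ ≫ q) ρB.aut_comp)]; infer_instance⟩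
  refine ComponentGluing.Scheme.HasResolution.of_isBirational
    (ρB.gluedDesc (𝟙 _ ≫ q) ρB.aut_comp) hrbir ?_
  -- the affine quotient `(Spec B)/G = Spec B^G` over `Spec B^G`
  let ρA : ActionOver (Spec.map (CommRingCat.ofHom
      (algebraMap (FixedPoints.subalgebra k B G) B))) G :=
    ⟨ρ, AffineQuotient.specAction_comp k ρ hρ⟩
  haveI hqb : IsIso ρA.quotientToBase := isIso_quotientToBase_affineQuotient k ρA (fun g => hρ g)
  haveI : IsAffine ρA.quotient := IsAffine.of_isIso ρA.quotientToBase
  -- `(Spec B)/G over X₁ ≅ (Spec B)/G over Spec B^G` by the two universal properties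
  let a : ρB.glued ⟶ ρA.quotient := ρB.gluedDesc ρA.toQuotient (fun g => ρA.aut_hom_toQuotient g)
  let b : ρA.quotient ⟶ ρB.glued := ρA.desc (ρB.gluedMk hcov) (fun g => ρB.aut_hom_gluedMk hcov g)
  have hab : a ≫ b = 𝟙 _ := by
    apply ρB.glued_hom_ext hcov
    rw [ρB.gluedMk_gluedDesc_assoc hcov, ActionOver.toQuotient_desc, Category.comp_id]
  have hba : b ≫ a = 𝟙 _ := by
    apply ρA.desc_unique
    rw [ActionOver.toQuotient_desc_assoc, ρB.gluedMk_gluedDesc hcov, Category.comp_id]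
  haveI : IsIso b := ⟨⟨a, hba, hab⟩⟩
  -- transport the resolution of `Spec B^G` along `Spec B^G ≅ (Spec B)/G ≅ glued`
  haveI : IsIso (inv ρA.quotientToBase ≫ b) := inferInstance
  exact ComponentGluing.Scheme.HasResolution.of_isBirational (inv ρA.quotientToBase ≫ b)
    ⟨⊤, by simp, by simp, inferInstance⟩ hres

/-- **S1c, affine-space model** (the rungs' shape). For every field `k`, every `n` and every
`k`-algebra automorphism `σ` of `k[x₁,…,xₙ]` of finite order (linear or not): each abstract
quotient datum of `CyclicQuotientFourfolds` / `WildQuotientResolution` whose top is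
`(𝔸ⁿ_k, ⟨σ⟩)` with the affine-quotient action — `q : 𝔸ⁿ → X₁` finite surjective `⟨σ⟩`-invariant
with orbit fibres, étale over a dense open, `X₁` integral separated of finite type (not assumed
normal or affine) — has `HasResolution X₁` as soon as
`HasResolution (Spec k[x]^⟨σ⟩)`, which is LITERALLY the conclusion of the landed rungs
(`jordanThree_hasResolution`, `jordanFour_hasResolution`, `linearCyclicQuotientFourfold_hasResolution`,
…). [OURS · L1 W4.5c] [folklore; instance of `hasResolution_of_affineQuotientModel`] -/
theorem hasResolution_of_affineSpaceModel (n : ℕ)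
    (σ : MvPolynomial (Fin n) k ≃ₐ[k] MvPolynomial (Fin n) k) [Finite ↥(Subgroup.zpowers σ)]
    (X₁ : Scheme.{0}) (f : X₁ ⟶ Spec (.of k))
    (q : Spec (.of (MvPolynomial (Fin n) k)) ⟶ X₁)
    (ρ : ↥(Subgroup.zpowers σ) →* Aut (Spec (.of (MvPolynomial (Fin n) k))))
    (hρ : ∀ g : ↥(Subgroup.zpowers σ), (ρ g).hom = Spec.map (CommRingCat.ofHom
      ((MulSemiringAction.toRingEquiv (↥(Subgroup.zpowers σ)) (MvPolynomial (Fin n) k) g⁻¹ :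
        MvPolynomial (Fin n) k ≃+* MvPolynomial (Fin n) k) :
          MvPolynomial (Fin n) k →+* MvPolynomial (Fin n) k)))
    [IsSeparated f] [LocallyOfFiniteType f] [IsIntegral X₁] [IsFinite q]
    (hsurj : Function.Surjective q.base)
    (hU : ∃ U : X₁.Opens, Dense (U : Set X₁) ∧ Etale (q ∣_ U))
    (hq : ∀ g : ↥(Subgroup.zpowers σ), (ρ g).hom ≫ q = q)
    (horb : ∀ x y : Spec (.of (MvPolynomial (Fin n) k)), q.base x = q.base y →
      ∃ g : ↥(Subgroup.zpowers σ), (ρ g).hom.base x = y)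
    (hres : Scheme.HasResolution (Spec (.of
      ↥(FixedPoints.subalgebra k (MvPolynomial (Fin n) k) ↥(Subgroup.zpowers σ))))) :
    Scheme.HasResolution X₁ :=
  hasResolution_of_affineQuotientModel k X₁ f q ρ hρ hsurj hU hq horb hres

end Port

end Summit.ResolutionOfSingularities.ResolutionOfSingularities.Theorems.WildQuotientResolution.QuotientModel

end
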